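import Summits.BirchSwinnertonDyer.Rank1Residual.Partition.AnticyclotomicLogConjugate
import Summits.BirchSwinnertonDyer.Rank1Residual.X2.NonsplitControl
import Summits.BirchSwinnertonDyer.Rank1Residual.X2.SplitHalvesAssembly
import Summits.BirchSwinnertonDyer.Rank1Residual.X11b.RouteR1IntReceptacle
import HarnessLib

/-!
# Crux 4 `BSDpOnCellC` (stmt-BirchSwinnertonDyer-19034), line b1: the LOG-EMBEDDING SYMMETRY that lets the
# RE-ORIENTED IMC atom (X-slot at `𝔭̄`, frame at `𝔭` — RULING L31 (R1), c3h MEMO-2) feed the b1 roads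
# (cell `bsd-eis`, seat `bsd-eis-cgshw` g12)

HONEST FRAMING (cell `bsd-eis`, run/shared/lean/pub/bsd-eis/): theorems only; nothing booked; X2 stays
CONSTRUCTION-SHAPED; no label or count moves; BSD is not proved by any of this.

## Why

The b1 roads combine, at ONE degree-one prime `𝔭 ∣ p` of a CGLS/Heegner field `K` and THE embedding
`embAt K p 𝔭 : K ↪ ℚ_p`, three links: the anticyclotomic control theorem `X11b.ControlOnTreeAt p κ 𝔭 γ
(embAt K p 𝔭) P` (X-slot = strict prime of `X_ac` = `𝔭`, logarithm at `𝔭`), the IMC atom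
`X11b.R1.IMCEqIntAt W p κ 𝔭 γ Q` for a ♭-frame `Q` at `(ι′, 𝔭)`, and the value atom
`X11b.R1.BDPValueAtOneIntAt W p (embAt K p 𝔭) P Q a_p`. Seat c3h (MEMO-2, p481783) showed that the
faithful (printed, Bloch–Kato-consistent) partner of a frame at `(ι′, 𝔭)` is `X_ac` STRICT AT THE OTHER
prime `𝔭̄`: the re-oriented atom c3♭′ concludes `X11b.R1.IMCEqIntAt W p κ 𝔭̄ γ Q`. To run the SAME roads on
c3♭′ one needs the control link with X-slot `𝔭̄` but logarithm at `𝔭`. Both tree predicates take the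
X-slot prime and the log-embedding as SEPARATE arguments, and the shadow-link consumer
`X11b.exists_shadowLinks_of_onTree_of_heegner` accepts ANY pair; the only missing piece is that in rank one
`ord_p log_{ω_E} P` does not depend on the embedding `K ↪ ℚ_p` — which the b2b cell proved as
`padicLogOrd_comp_eq_of_rank_one` (`Partition/AnticyclotomicLogConjugate.lean`: along `ι ∘ σ` = along
`ι` for an involution `σ`). This file packages it for the X2c roads:

* §1 `exists_algEquiv_eq_comp` — two ring embeddings of a quadratic number field into a field of
  characteristic `0` differ by an automorphism (`AlgHom.restrictNormal'`); `algEquiv_apply_apply` — every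
  automorphism of a quadratic field is an involution (`#Aut = 2`).
* §2 `padicLogOrd_eq_of_finrank_eq_two` — `padicLogOrd W p ι₂ P = padicLogOrd W p ι₁ P` for ANY two
  embeddings `ι₁ ι₂ : K →+* ℚ_p` of a quadratic `K`, `rank_ℤ E(K) = 1`, `P` non-torsion, `p` odd.
* §3 `controlOnTreeAt_of_padicLogOrd_eq` / `imcWaldspurgerOnTreeAt_of_padicLogOrd_eq` — the two links
  move along an equality of `padicLogOrd` (their displayed integer is the only place the embedding enters).
* §4 `imcWaldspurgerOnTreeAt_of_intHalves_of_controlOnTreeAt` — SIGN-FREE: CTL at `(𝔮, ι′)` (for the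
  torsion/`f(0) ≠ 0` witness), c3 at X-slot `𝔮` for `Q`, c2 at `ι` for the same `Q`, `p ∤ a`, and
  `padicLogOrd … ι′ P = padicLogOrd … ι P` ⟹ (IMC∘BDP)@`𝟙` at `(𝔮, ι′)`; then the two instantiations the
  re-oriented roads use: `…_other_of_not_split_of_rankOne` (CTL = the tree's theorem
  `X2.controlOnTreeAt_of_not_split_of_rankOne` at the other degree-one prime) and `…_other_of_splitControl`
  (CTL = the split predicate `X2.SplitControlOnTree W p`, a THEOREM class-wide by k5-c4's
  `Theorems.CtlLoc.splitControlOnTree_of_cellC`, instantiated at the other prime).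

What this is NOT: not a proof of any IMC; not an `ι`-transport of `X_ac` (RULING L31 (R4), optional,
several hundred lines — not needed for the roads); nothing about which convention print uses.

References: [Castella2018] Thm. 2.3, §5 (5.1)–(5.2) (arXiv:1704.06608 pp. 5, 12); [JetchevSkinnerWan2017]
§2.3.2–2.3.3, Thm. 3.3.1 (arXiv:1512.06894 pp. 7, 10–11); [CastellaGrossiLeeSkinner2022] Thm. 5.1.1
(log at the prime induced by `ι_p`, module strict at `v̄`); cell memos c3h MEMO-2 (7e0f0350), RULING L31.
-/

set_option autoImplicit false
set_option linter.dupNamespace false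

noncomputable section

open scoped Classical

open WeierstrassCurve NumberField IsDedekindDomain Field Literature.NumberTheory.EllipticCurves
  Literature.NumberTheory.EllipticCurves.ModularForms
  Literature.NumberTheory.EllipticCurves.Rank1Residual
  Literature.NumberTheory.EllipticCurves.Rank1Residual.Typed
  Literature.NumberTheory.GaloisRepresentations Literature.NumberTheory.GaloisCohomology
  Summit.BirchSwinnertonDyer.Rank1Residual.X11b.AcSelmer
  Summit.BirchSwinnertonDyer.Rank1Residual.X11b
  Summit.BirchSwinnertonDyer.Rank1Residual.X2

namespace Summit.BirchSwinnertonDyer.BirchSwinnertonDyer.Theorems.LogSymmetry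

/-! ### §1 Two embeddings of a quadratic field differ by an involution -/

section Quadratic

variable {K : Type} [Field K] [NumberField K] {L : Type*} [Field L] [CharZero L]

/-- **Two ring embeddings of a quadratic number field into a field of characteristic `0` differ by an
automorphism**: `ι₂ = ι₁ ∘ σ` for some `σ ∈ Aut(K/ℚ)` (`K/ℚ` is Galois; `σ` = the restriction of `ι₂` to the
normal extension `K` seen inside `L` through `ι₁`, Mathlib `AlgHom.restrictNormal'`). [folklore] -/
theorem exists_algEquiv_eq_comp (h2 : Module.finrank ℚ K = 2) (ι₁ ι₂ : K →+* L) :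
    ∃ σ : K ≃ₐ[ℚ] K, ι₂ = ι₁.comp (σ : K →+* K) := by
  haveI : Algebra.IsQuadraticExtension ℚ K := ⟨h2⟩
  haveI : IsGalois ℚ K := inferInstance
  letI : Algebra K L := ι₁.toAlgebra
  haveI : IsScalarTower ℚ K L := IsScalarTower.of_algebraMap_eq fun q ↦ by
    rw [RingHom.algebraMap_toAlgebra, eq_ratCast, eq_ratCast, map_ratCast]
  refine ⟨(ι₂.toRatAlgHom).restrictNormal' K, RingHom.ext fun x ↦ ?_⟩
  have h := AlgHom.restrictNormal_commutes ι₂.toRatAlgHom K x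
  rw [RingHom.algebraMap_toAlgebra] at h
  show ι₂ x = ι₁ ((ι₂.toRatAlgHom).restrictNormal K x)
  simpa using h.symm

/-- **Every automorphism of a quadratic field is an involution** (`#Aut(K/ℚ) = [K:ℚ] = 2`). [folklore] -/
theorem algEquiv_apply_apply (h2 : Module.finrank ℚ K = 2) (σ : K ≃ₐ[ℚ] K) (x : K) : σ (σ x) = x := by
  haveI : Algebra.IsQuadraticExtension ℚ K := ⟨h2⟩
  haveI : IsGalois ℚ K := inferInstance
  have hcard : Nat.card (K ≃ₐ[ℚ] K) = 2 := (IsGalois.card_aut_eq_finrank ℚ K).trans h2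
  have hσ : σ * σ = 1 := by
    have h := pow_card_eq_one' (G := K ≃ₐ[ℚ] K) (x := σ)
    rwa [hcard, pow_two] at h
  have := congrArg (fun τ : K ≃ₐ[ℚ] K ↦ τ x) hσ
  simpa [AlgEquiv.mul_apply] using this

end Quadratic

/-! ### §2 `ord_p log_{ω_E} P` does not depend on the embedding (quadratic `K`, rank one) -/

section Log

variable (W : WeierstrassCurve ℚ) [W.IsElliptic] [W.IsGloballyMinimal] (p : ℕ) [Fact p.Prime]
  {K : Type} [Field K] [NumberField K]

/-- **`ord_p log_{ω_E}(P)` is the same along ANY two embeddings `K ↪ ℚ_p`** of a quadratic `K` when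
`rank_ℤ E(K) = 1`, `P` is non-torsion and `p` is odd: the embeddings differ by an involution `σ` of `K`
(§1) and `padicLogOrd_comp_eq_of_rank_one` (b2b cell: `σ_* P = ±P + torsion`, `log` odd, torsion dies in
`E₁(ℚ_p)`). For `K` imaginary quadratic with `p` split this is "`ord_p log_𝔭 P = ord_p log_𝔭̄ P`".
[cite: CastellaGrossiLeeSkinner2022, Thm. 5.1.1 (log at the prime induced by `ι_p`)]
[cite: JetchevSkinnerWan2017, §2.3.2 and §3.2 (log at the strict prime)] -/
theorem padicLogOrd_eq_of_finrank_eq_two (hp : p ≠ 2) (h2 : Module.finrank ℚ K = 2)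
    (ι₁ ι₂ : K →+* ℚ_[p]) (hrk : (W.baseChange K).mordellWeilRank = 1)
    (P : (W.baseChange K).toAffine.Point) (hP : ¬ IsOfFinAddOrder P) :
    Rank1Residual.X11b.padicLogOrd W p ι₂ P = Rank1Residual.X11b.padicLogOrd W p ι₁ P := by
  obtain ⟨σ, rfl⟩ := exists_algEquiv_eq_comp h2 ι₁ ι₂
  exact Summit.BirchSwinnertonDyer.Rank1Residual.padicLogOrd_comp_eq_of_rank_one W p hp (σ : K →+* K)
    (fun x ↦ by simpa using algEquiv_apply_apply h2 σ x) ι₁ hrk P hP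

end Log

/-! ### §3 The two links move along an equality of `padicLogOrd` -/

section Transport

variable {W : WeierstrassCurve ℚ} [W.IsElliptic] [W.IsGloballyMinimal] {K : Type} [Field K]
  [NumberField K] {p : ℕ} [Fact p.Prime] {κ : ZpExtension K p} {𝔮 : HeightOneSpectrum (𝓞 K)}
  {γ : Field.absoluteGaloisGroup K} [Fact (κ.IsTopGenerator γ)] {ι ι' : K →+* ℚ_[p]}
  {P : (W.baseChange K).toAffine.Point}

/-- (CTL) at `(𝔮, ι)` ⟹ (CTL) at `(𝔮, ι′)` when `ord_p log` agrees along `ι` and `ι′` (the embedding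
enters the predicate only through `padicLogOrd`). [cite: Castella2018, Thm. 2.3 (arXiv:1704.06608 p. 5) (shape)] -/
theorem controlOnTreeAt_of_padicLogOrd_eq (hlog : Rank1Residual.X11b.padicLogOrd W p ι' P = Rank1Residual.X11b.padicLogOrd W p ι P)
    (h : ControlOnTreeAt p κ 𝔮 γ ι P) : ControlOnTreeAt p κ 𝔮 γ ι' P := by
  obtain ⟨n, hn, hne⟩ := h
  exact ⟨n, hn, by rw [hlog]; exact hne⟩

/-- (IMC∘BDP)@`𝟙` at `(𝔮, ι)` ⟹ at `(𝔮, ι′)` when `ord_p log` agrees along `ι` and `ι′`.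
[cite: Castella2018, §5 (5.1) (arXiv:1704.06608 p. 12) (shape)] -/
theorem imcWaldspurgerOnTreeAt_of_padicLogOrd_eq (hlog : Rank1Residual.X11b.padicLogOrd W p ι' P = Rank1Residual.X11b.padicLogOrd W p ι P)
    (h : IMCWaldspurgerOnTreeAt p κ 𝔮 γ ι P) : IMCWaldspurgerOnTreeAt p κ 𝔮 γ ι' P := by
  obtain ⟨n, hn, hne⟩ := h
  exact ⟨n, hn, by rw [hlog]; exact hne⟩

end Transport

/-! ### §4 The re-oriented ♭ halves ⟹ (IMC∘BDP)@`𝟙` at the X-slot prime, sign-free and instantiated -/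

section Halves

variable {W : WeierstrassCurve ℚ} [W.IsElliptic] [W.IsGloballyMinimal] {K : Type} [Field K]
  [NumberField K] {p : ℕ} [Fact p.Prime] {κ : ZpExtension K p} {𝔮 : HeightOneSpectrum (𝓞 K)}
  {γ : Field.absoluteGaloisGroup K} [Fact (κ.IsTopGenerator γ)] {ι ι' : K →+* ℚ_[p]}
  {P : (W.baseChange K).toAffine.Point}

/-- **SIGN-FREE: re-oriented ♭ halves ⟹ the composite link at the X-slot prime.** Given (CTL) at
`(𝔮, ι′)` (only its `Λ`-torsion / `f(0) ≠ 0` witness `HasCharValuationAt … 𝔮 … n` is used), the IMC atom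
`R1.IMCEqIntAt W p κ 𝔮 γ Q` (X-slot `𝔮`) and the value atom `R1.BDPValueAtOneIntAt W p ι P Q a` (logarithm
along `ι`) for the SAME `Q`, `p ∤ a`, and `padicLogOrd … ι′ P = padicLogOrd … ι P`: the composite
`IMCWaldspurgerOnTreeAt p κ 𝔮 γ ι′ P` (X-slot `𝔮`, logarithm along `ι′`). Proof:
`X11b.R1.imcWaldspurgerOnTreeAt_of_intHalves` (its embedding is free) at `ι`, then §3.
[cite: Castella2018, §5 (5.1) (arXiv:1704.06608 p. 12)] [cite: Castella2018Erratum, Thm. 1.1 (p. 1) (shape)] -/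
theorem imcWaldspurgerOnTreeAt_of_intHalves_of_controlOnTreeAt
    (hCTL : ControlOnTreeAt p κ 𝔮 γ ι' P) {Q : PowerSeries 𝓞_ℂ_[p]} (h3 : R1.IMCEqIntAt W p κ 𝔮 γ Q)
    {a : ℤ} (ha : ¬ (p : ℤ) ∣ a) (h2 : R1.BDPValueAtOneIntAt W p ι P Q a)
    (hlog : Rank1Residual.X11b.padicLogOrd W p ι' P = Rank1Residual.X11b.padicLogOrd W p ι P) : IMCWaldspurgerOnTreeAt p κ 𝔮 γ ι' P := by
  obtain ⟨n, hn, -⟩ := hCTL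
  exact imcWaldspurgerOnTreeAt_of_padicLogOrd_eq hlog (R1.imcWaldspurgerOnTreeAt_of_intHalves hn h3 ha h2)

end Halves

section Instances

variable (W : WeierstrassCurve ℚ) [W.IsElliptic] [W.IsGloballyMinimal] (p : ℕ) [Fact p.Prime]

/-- **NON-SPLIT, re-oriented: c3♭′ at X-slot `𝔭̄` + c2♭ with the logarithm at `𝔭` ⟹ (IMC∘BDP)@`𝟙` at
`(𝔭̄, embAt K p 𝔭̄)`** for a rank-one non-split multiplicative pair, a CGLS field `K` (imaginary quadratic,
`p` split, `L(E^{d_K},1) ≠ 0`), `P` non-torsion, `(κ, γ)`, degree-one primes `𝔭, 𝔭̄ ∣ p` (no `𝔭̄ ≠ 𝔭`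
needed here). CTL at `𝔭̄` is the tree THEOREM `X2.controlOnTreeAt_of_not_split_of_rankOne` (five cited
cohomological facts + GZK/modularity); the logarithm moves from `𝔭` to `𝔭̄` by §2 (`rank E(K) = 1` from
`X2.mordellWeilRank_eq_one_and_shaFinite_of_twist`). CONDITIONAL on the listed facts and the two ♭ atoms at
`Q`. [cite: Castella2018, Thm. 2.3 and §5 (5.1) (arXiv:1704.06608 pp. 5, 12)]
[cite: JetchevSkinnerWan2017, Thm. 3.3.1 (arXiv:1512.06894 p. 11)] [claim: KellerYin2024, status: under-review] -/
theorem imcWaldspurgerOnTreeAt_other_of_intHalves_of_not_split_of_rankOne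
    (hGZK : rank_eq_analyticRank_of_analyticRank_le_one) (hnf : exists_isNewformOf)
    (hPT : ∀ (K : Type) [Field K] [NumberField K], poitouTate_selmerStructure_duality K)
    (hPT2 : ∀ (K : Type) [Field K] [NumberField K], poitouTate_sha_tateDual K)
    (hEP : ∀ (K : Type) [Field K] [NumberField K] (v : HeightOneSpectrum (𝓞 K)),
      localEulerPoincareCharacteristic (v.adicCompletion K))
    (hcd : fieldCdLE_two_of_numberField)
    (hBr : ∀ (K : Type) [Field K] [NumberField K] (p : ℕ) [Fact p.Prime],
      ZpExtension.decomp_not_le_kerSubgroup_of_isAnticyclotomic K p)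
    (hp2 : p ≠ 2) (hmult : Mult W p) (hns : ¬ W.HasSplitMultiplicativeReductionAtPrime p)
    (hr : W.analyticRank = 1) {K : Type} [Field K] [NumberField K] (hK : IsImaginaryQuadratic K)
    (hsplit : SplitsIn K p) (hLt : (W.quadraticTwist (NumberField.discr K : ℚ)).entireLFunction 1 ≠ 0)
    (P : (W.baseChange K).toAffine.Point) (hPinf : ¬ IsOfFinAddOrder P)
    (κ : ZpExtension K p) (hκ : κ.IsAnticyclotomic) (γ : absoluteGaloisGroup K)
    [Fact (κ.IsTopGenerator γ)] (𝔭 𝔭bar : HeightOneSpectrum (𝓞 K))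
    (h𝔭 : ((p : ℕ) : 𝓞 K) ∈ 𝔭.asIdeal) (he : 𝔭.asIdeal.ramificationIdx (𝓞 ℚ) = 1)
    (hf : 𝔭.asIdeal.inertiaDeg (𝓞 ℚ) = 1)
    (h𝔭bar : ((p : ℕ) : 𝓞 K) ∈ 𝔭bar.asIdeal) (hebar : 𝔭bar.asIdeal.ramificationIdx (𝓞 ℚ) = 1)
    (hfbar : 𝔭bar.asIdeal.inertiaDeg (𝓞 ℚ) = 1) (Q : PowerSeries 𝓞_ℂ_[p])
    (h3 : R1.IMCEqIntAt W p κ 𝔭bar γ Q)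
    (h2 : R1.BDPValueAtOneIntAt W p (embAt K p 𝔭 h𝔭 he hf) P Q (W.LFunction p)) :
    IMCWaldspurgerOnTreeAt p κ 𝔭bar γ (embAt K p 𝔭bar h𝔭bar hebar hfbar) P := by
  haveI : NeZero (W.conductorNorm ℤ) := ⟨(W.conductorNorm_pos_holds).ne'⟩
  obtain ⟨f, hfW⟩ := hnf W
  have hCTL := controlOnTreeAt_of_not_split_of_rankOne W p hGZK hnf hPT hPT2 hEP hcd hBr hp2 hmult hns
    hr hK hsplit hLt P hPinf κ hκ γ 𝔭bar h𝔭bar hebar hfbar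
  obtain ⟨hrank, -⟩ := mordellWeilRank_eq_one_and_shaFinite_of_twist W hGZK hnf hr hK.1 hLt
  exact imcWaldspurgerOnTreeAt_of_intHalves_of_controlOnTreeAt hCTL h3
    (R1.not_dvd_lFunction_of_mult hfW hmult) h2
    (padicLogOrd_eq_of_finrank_eq_two W p hp2 hK.1 _ _ hrank P hPinf)

/-- **SPLIT, re-oriented: c3s♭′ at X-slot `𝔭̄` + c2s♭ with the logarithm at `𝔭` ⟹ (IMC∘BDP)@`𝟙` at
`(𝔭̄, embAt K p 𝔭̄)`** at a SPLIT CellC pair, the control input being the split predicate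
`X2.SplitControlOnTree W p` (a THEOREM class-wide: `Theorems.CtlLoc.splitControlOnTree_of_cellC`, k5-c4
g5 p484252) instantiated at `𝔭̄`; the logarithm moves by §2. CONDITIONAL on `hCTL` and the two ♭ atoms at
`Q`. [cite: Castella2018, Thm. 2.3 and §5 (5.1) (arXiv:1704.06608 pp. 5, 12)]
[cite: Castella2018Exceptional, Thm. 2.11 (arXiv:1507.04260 p. 14) (value shape at a split p)]
[claim: KellerYin2024, status: under-review] -/
theorem imcWaldspurgerOnTreeAt_other_of_intHalves_of_splitControl
    (hGZK : rank_eq_analyticRank_of_analyticRank_le_one) (hnf : exists_isNewformOf)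
    (hc : CellC W p) (hs : W.HasSplitMultiplicativeReductionAtPrime p) (hCTL : SplitControlOnTree W p)
    {K : Type} [Field K] [NumberField K] (hK : IsImaginaryQuadratic K)
    (hHp : SatisfiesHeegnerHypothesis p K)
    (hLt : (W.quadraticTwist (NumberField.discr K : ℚ)).entireLFunction 1 ≠ 0)
    (P : (W.baseChange K).toAffine.Point) (hPinf : ¬ IsOfFinAddOrder P)
    (κ : ZpExtension K p) (hκ : κ.IsAnticyclotomic) (γ : absoluteGaloisGroup K)
    [Fact (κ.IsTopGenerator γ)] (𝔭 𝔭bar : HeightOneSpectrum (𝓞 K))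
    (h𝔭 : ((p : ℕ) : 𝓞 K) ∈ 𝔭.asIdeal) (he : 𝔭.asIdeal.ramificationIdx (𝓞 ℚ) = 1)
    (hf : 𝔭.asIdeal.inertiaDeg (𝓞 ℚ) = 1)
    (h𝔭bar : ((p : ℕ) : 𝓞 K) ∈ 𝔭bar.asIdeal) (hebar : 𝔭bar.asIdeal.ramificationIdx (𝓞 ℚ) = 1)
    (hfbar : 𝔭bar.asIdeal.inertiaDeg (𝓞 ℚ) = 1) (Q : PowerSeries 𝓞_ℂ_[p])
    (h3 : R1.IMCEqIntAt W p κ 𝔭bar γ Q)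
    (h2 : R1.BDPValueAtOneIntAt W p (embAt K p 𝔭 h𝔭 he hf) P Q (W.LFunction p)) :
    IMCWaldspurgerOnTreeAt p κ 𝔭bar γ (embAt K p 𝔭bar h𝔭bar hebar hfbar) P := by
  haveI : NeZero (W.conductorNorm ℤ) := ⟨(W.conductorNorm_pos_holds).ne'⟩
  obtain ⟨f, hfW⟩ := hnf W
  have hctl : ControlOnTreeAt p κ 𝔭bar γ (embAt K p 𝔭bar h𝔭bar hebar hfbar) P :=
    hCTL K P hc hs hK hHp hLt hPinf κ hκ γ 𝔭bar h𝔭bar hebar hfbar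
  obtain ⟨hrank, -⟩ := mordellWeilRank_eq_one_and_shaFinite_of_twist W hGZK hnf hc.1 hK.1 hLt
  exact imcWaldspurgerOnTreeAt_of_intHalves_of_controlOnTreeAt hctl h3
    (R1.not_dvd_lFunction_of_mult hfW hc.2.2.2) h2
    (padicLogOrd_eq_of_finrank_eq_two W p hc.2.1 hK.1 _ _ hrank P hPinf)

end Instances

end Summit.BirchSwinnertonDyer.BirchSwinnertonDyer.Theorems.LogSymmetry

end
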